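import Literature.Geometry.Lorentzian.MassInequalities
import HarnessLib

/-!
# Harmonic asymptotics and the Eichmair–Huang–Lee–Schoen density theorem
(family `gr`, proof architecture of **gr.S10** `positive_mass_theorem_spacetime`; trunk
G08 = T-LORENTZ; namespace `Literature.Geometry.Lorentzian`)

Eichmair–Huang–Lee–Schoen prove the spacetime positive mass theorem `E ≥ |P|`
(J. Eur. Math. Soc. 18 (2016), Thm. 1; vendored as the named fact
`Literature.Geometry.Lorentzian.positive_mass_theorem_spacetime` in `MassInequalities.lean`) in two steps (§3, first
paragraph): *"By the density theorem (Theorem 18), we can assume without loss of generality that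
`(g, k)` has harmonic asymptotics and satisfies the strict dominant energy condition
`μ > |J|_g`"*, followed by the geometric argument of §3–§4 (construction of marginally outer
trapped surfaces and, for `n = 3`, a contradiction with the Gauss–Bonnet theorem). This file
vendors the notions of the first step, in dimension `n = 3` and in the chart of an end
`e : AFEnd X` (open-end design of `AsymptoticFlatness.lean`):

* `MemWeightedHolder R₁ k α q f`: the function `f` on the exterior region `{R₁ < ‖x‖}` of a real
  normed space lies in the weighted Hölder class `C^{k,α}_{-q}` of EHLS §2, Def. 2, transcribed
  literally: `|x|^{m+q} |D^m f(x)|` is bounded for `m ≤ k`, and the weighted top derivative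
  `x ↦ |x|^{k+q} D^k f(x)` has finite `α`-Hölder seminorm `[·]_α` on the region
  (`‖|x|^{k+q} D^k f(x) - |y|^{k+q} D^k f(y)‖ ≤ C |x - y|^α` for all `x, y` there).
* `InitialDataSet.SatisfiesStrictDominantEnergyCondition D`: `|J|_h < μ` everywhere (EHLS §3 and
  Thm. 18).
* `AFEnd.momentumTensorCoeff e D i j`: the chart components `π_ij = k_ij - (tr_h k) h_ij` of the
  momentum tensor (EHLS §2, Def. 3), the integrand of `AFEnd.admMomentumFlux`.
* `modifiedLieDerivCoeff Y i j`: `(L_Y δ)_ij - (div_δ Y) δ_ij` for a vector field `Y` on `E3`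
  (EHLS §2, Def. 4 and §6.1, the "modified Lie derivative" at the flat metric).
* `AFEnd.HasHarmonicAsymptotics e D α`: EHLS §2, Def. 4 for `n = 3`: outside a larger ball,
  `h_ij = u⁴ δ_ij` and `π_ij = u² [(L_Y δ)_ij - (div_δ Y) δ_ij]` with
  `u = 1 + a/|x| + O^{2,α}(|x|⁻²)` and `Y_i = b_i/|x| + O^{2,α}(|x|⁻²)`.
* `AFEnd.HasHarmonicApproximation e D ε`: the conclusion of the density theorem, EHLS Thm. 18
  (§6) for `n = 3`, as a *predicate* on the data — complete data `D'` on the same `X`, read in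
  the same chart `e`, with the strict dominant energy condition, harmonic asymptotics and ADM
  energy–momentum limits `ε`-close to those of `D` (the conclusions that the reduction of Thm. 1
  consumes) — with `HasHarmonicApproximation.pos`, `.mono` and the trivial case
  `hasHarmonicApproximation_self` (data that are already harmonic approximate themselves). The
  density theorem itself — "for data as in `positive_mass_theorem_spacetime` and every `ε > 0`,
  `e.HasHarmonicApproximation D ε`" — is the explicit hypothesis `hd` of the reduction and **not**
  a named fact (two paragraphs below).

* `Literature.Geometry.Lorentzian.positive_mass_theorem_spacetime_of_density`: the reduction
  itself, **proved** — the density theorem (first step, hypothesis `hd`) together with the second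
  step, *EHLS Thm. 1 for `n = 3` on the data the first step reduces to* (strict dominant energy
  condition and harmonic asymptotics, with the remaining hypotheses of
  `positive_mass_theorem_spacetime`: one end, completeness, existence of the ADM limits;
  hypothesis `hh`), imply `positive_mass_theorem_spacetime` by the printed `ε`-argument
  (`|P| ≤ |P̄| + |P - P̄| ≤ Ē + |P - P̄| < E + ε` for every `ε > 0`), with the elementary
  Euclidean-length lemmas `sqrt_sum_sq_eq_norm`, `sqrt_sum_sq_le_add`,
  `sqrt_sum_sq_sub_lt_of_abs_lt`. Both steps enter as explicit hypotheses of the theorem, spelled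
  out in full; neither is a named fact (next two paragraphs).

*Why the harmonic-asymptotics case is a hypothesis and not a named fact* (D-0026 review of the
decomposition, 2026-08-15; it was briefly the named fact
`EichmairHuangLeeSchoen_harmonicAsymptoticsCase`, now merged back into the proof obligation of
`positive_mass_theorem_spacetime`). It is Thm. 1 itself on a dense subclass of its data: the
source gives it no separate statement (§3, first paragraph, is a "without loss of generality"),
and its proof is the whole geometric content of the paper — §3 Lemma 5 (the planes `x³ = ±Λ`
are barriers when `E < |P|`), Lemma 6 (stable MOTS `Σ_{ρ,h}` with prescribed boundary in the
cylinder `C_{ρ,Λ}`, from Eichmair's Plateau theory for MOTS and `λ`-minimising boundaries, the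
only place where `n < 8` enters), Lemmas 7–8 (envelopes; the complete properly embedded limit
MOTS `Σ_∞`, a graph `xⁿ = c + O^{3,α}(|x'|^{3-n})` near infinity, by Allard regularity and
asymptotic analysis), Lemma 10 (its stability inequality `∫ |∇v|² + Q v² ≥ 0`) and §4 (`n = 3`:
logarithmic cut-off, `∫ Q ≥ 0`, strict dominant energy condition `⟹ ∫ K > 0`, contradicting
the Gauss–Bonnet theorem on `Σ'_∞ ∩ C_r`) — none of which is a separately citable result of
moderate size, and whose statements need marginally outer trapped surfaces *with boundary*, the
MOTS stability operator and `λ`-minimising currents, none of which the tree has. As a named fact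
it would therefore only duplicate the debt `positive_mass_theorem_spacetime` (EHLS Thm. 1 for
`n = 3`, `MassInequalities.lean`) without being any more provable.

*Why the density theorem is a hypothesis too, and not a named fact* (D-0026 review of the
decomposition child `EichmairHuangLeeSchoen_densityTheorem`, 2026-08-15). Unlike the harmonic
case, the density theorem *is* a distinct published result with its own locator and proof (EHLS
§6, Thm. 18, announced in §1 as "the relevant density theorem and its proof, which may be of
independent interest"; Eichmair, Comm. Math. Phys. 319 (2013), Thm. 2), and the review found its
Lean statement faithful (below, *Design choices*) and the result established in print (§6), not
open. It is nevertheless not kept as a separately seated named fact, for three reasons.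
(i) *Size.* Its proof is a theory the tree does not have and cannot yet state: weighted Sobolev
and Hölder spaces `W^{k,p}_{-q}`, `C^{k,α}_{-q}` on asymptotically flat ends (Defs. 1–2) with the
Fredholm, index-`0` property of the linearised operator
`DT|_{(1,0)} : W^{2,p}_{-q} → W^{0,p}_{-2-q}` for `0 < q < n - 2` (Bartnik 1986; EHLS Lemma 21 and
§6.2), the surjectivity of the linearised constraint map `DΦ|_{(g,π)}` (Corvino–Schoen 2006; EHLS
Lemma 20), the deformation to `μ̄ > (1 + γ) |J̄|_ḡ` by a Taylor expansion of the constraint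
operator in weighted norms (Thm. 22), the Corvino–Schoen cut-off construction with an inverse
function theorem uniform in the cut-off scale `λ` (Lemma 23), Meyers' 1963 expansion at infinity
with weighted Schauder estimates and a bootstrap, used twice (Lemma 21; Prop. 24, where for
`n = 3` the quadratic source terms `2|b|²/|x|⁴ + 3(b·x)²/2|x|⁶` of `Δ_δ u` must first be removed
by hand), the continuity of `(E, P)` on the space of data (Prop. 19, divergence theorem on
exterior regions), and the assembly of §6.3 (the cut-off `ξ_l ∼ |x|⁻¹` of the sources, which
upgrades `q₀` to `q₀ + 1 > 1` as Prop. 24 requires, while preserving strictness); on the tree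
side, moreover, a new *smooth* `InitialDataSet` on `X` glued from chart data, with its scalar
curvature, divergence and geodesic completeness identified with the chart computations. None of
the printed pieces (Prop. 19, Lemmas 20–23, Thm. 22, Prop. 24) is of moderate size, nor even
statable without the weighted Sobolev vocabulary; the prove-seat's triage ("XL, atomic") was
right, and decompositions do not recurse (D-0026). (ii) *Use.* Its only consumer is the
reduction below, i.e. the proof obligation of `positive_mass_theorem_spacetime`, whose source —
the same paper — it shares; with the harmonic case a hypothesis, assuming Thm. 18 as a fact lets
the tree derive nothing it claims, so as a trust-base entry it only counted the debt of EHLS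
Thm. 1 a second time. (iii) *Nothing is lost by keeping it in the text.* The per-`ε` conclusion is
the parametrised predicate `AFEnd.HasHarmonicApproximation` (vocabulary, not a claim); the
hypothesis `hd` of the reduction is, byte for byte, the statement of the former fact with that
predicate folded in (definitionally equal to it: checked by `Iff.rfl` against the tree before the
merge); and its audit against the printed theorem is recorded under *Design choices*. Whoever
discharges `positive_mass_theorem_spacetime` along EHLS proves `hd` and `hh` as lemmas and applies
the reduction; a named fact for Thm. 18 should be (re-)vendored only together with a consumer
other than this reduction (results that invoke the density theorem as a black box, e.g. on the
equality case `E = |P|` or on the centre of mass), reusing `HasHarmonicApproximation` and the cite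
of this file. Net effect of the two reviews: the decomposition's two unproved facts are gone; the
proved reduction and all notions stay. The time-symmetric corollary
(`positive_mass_theorem_riemannian` from `positive_mass_theorem_spacetime`) is
`positive_mass_theorem_riemannian_of_spacetime` in `MassInequalitiesProofs.lean`.

## Mathlib

Mathlib has Hölder functions (`HolderWith`, `HolderOnWith`) but no weighted Hölder or weighted
Sobolev classes on exterior domains, and none of the relativity notions
(`lean search 'weighted.*Holder|HarmonicAsymptotics|dominant energy'` finds only
`Literature/Geometry/Lorentzian/*`). `Literature.Geometry.Lorentzian.WeightedNorms` has weighted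
`C^k` and `H^s` *seminorms* with `(1 + ‖x‖)`-weights (no Hölder part); the membership predicate
here is stated directly with `‖x‖`-weights as in EHLS, Def. 2. We use `iteratedFDeriv`,
`ContDiffOn`, `fderiv`, `innerSL ℝ`, `EuclideanSpace.single`, `Real.rpow`, `Asymptotics.IsBigO`
along `Bornology.cobounded`, and the H21 Lorentz prelude (`AFEnd.hCoeff`, `kCoeff`, `trKCoeff`,
`HasADMEnergy`, `HasADMMomentum`, `admEnergy`, `admMomentum`, `IsSoleEnd`,
`IsAsymptoticallyFlat`, `InitialDataSet.energyDensity`, `momentumDensity`,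
`SatisfiesDominantEnergyCondition`, `IsComplete`, `PseudoRiemannianMetric.innerDual`,
`Literature.Geometry.Lorentzian.HasSourceDecay`).

## Design choices

* *Weighted Hölder class: the printed norm, transcribed literally.* EHLS, Def. 2 define
  `‖f‖_{C^{k,α}_{-q}}` as
  `∑_{|I| ≤ k} sup_x ||x|^{|I|+q} ∂^I f(x)| + ∑_{|I| = k} [|x|^{|I|+q} ∂^I f]_α`, `[·]_α` the
  `α`-Hölder seminorm on the exterior region. `MemWeightedHolder` records exactly
  this: the weighted sup bounds for `m ≤ k`, and
  `‖|x|^{k+q} D^k f(x) - |y|^{k+q} D^k f(y)‖ ≤ C |x - y|^α` for *all* `x, y` in the region (the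
  seminorm of the weighted top derivative). The *standard* scale-invariant class (Bartnik,
  Comm. Pure Appl. Math. 39 (1986), (1.3); Lee, *Geometric Relativity*, App. A:
  `sup_{|x-y| ≤ |x|/2} |x|^{k+α+q} |D^k f(x) - D^k f(y)| / |x - y|^α < ∞` together with the sup
  bounds), to which Eichmair (Comm. Math. Phys. 319 (2013), p. 3: "the (standard) weighted
  Sobolev and Hölder spaces ... are given in [EHLS]") alludes, is *contained* in the printed
  class on every exterior region `{R₁ < ‖x‖}` with `R₁ > 0` (for `|x - y| ≤ |x|/2` split
  `|x|^{k+q} D^k f(x) - |y|^{k+q} D^k f(y)` as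
  `|x|^{k+q} (D^k f(x) - D^k f(y)) + (|x|^{k+q} - |y|^{k+q}) D^k f(y)` and use
  `|x - y|^{1-α} ≤ |x|^{1-α}`, `|x|^{-α} ≤ R₁^{-α}`; for `|x - y| > max(|x|, |y|)/2 > R₁/2` use the
  sup bound), and strictly smaller (`k = 0`: `f = |x|^{-q} sin |x|` has `|x|^q f`
  bounded and Lipschitz but `|x|^{α+q} |f(x) - f(y)| / |x - y|^α` unbounded over
  `|x - y| = π/2`). Hence a statement *concluding* membership in `MemWeightedHolder` (the
  density hypothesis `hd` below, through `HasHarmonicApproximation` and `HasHarmonicAsymptotics`)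
  is implied by the same statement in the standard reading, and is the printed statement in the
  literal reading; the one statement
  *assuming* harmonic asymptotics (the hypothesis `hh` of
  `positive_mass_theorem_spacetime_of_density`) is checked in its docstring against the
  hypotheses of EHLS, Thm. 1 under both readings. We use the full Fréchet derivative
  `D^m f = iteratedFDeriv ℝ m f` (its components are the coordinate partials `∂^I f`, so on the
  finite-dimensional chart space the class is that of Def. 2, which sums over `|I| = k`) and
  require `f` to be `C^k` on the open exterior region, on which `iteratedFDeriv` is the honest
  derivative (pattern of `AFEnd.IsAsymptoticallyFlat`).
* *Harmonic asymptotics (Def. 4) for `n = 3`.* `4/(n-2) = 4`, `2/(n-2) = 2`, `|x|^{2-n} = |x|⁻¹`,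
  `|x|^{1-n} = |x|⁻²`. The chart functions `hCoeff`, `kCoeff`, `trKCoeff` of
  `AsymptoticFlatness.lean` carry junk values inside the ball `‖x‖ ≤ e.R`; all identities are
  required only on `{R₁ < ‖x‖}` for some `R₁ ≥ e.R` ("there is a compact set `K` and a
  diffeomorphism `M ∖ K ≅ ℝⁿ ∖ B`" — the ball may be enlarged). Def. 4 also asks
  `u, Y ∈ C^{2,α}_{2-n}`; this follows from the expansions (`a|x|⁻¹ ∈ C^{2,α}_{-1}` and
  `C^{2,α}_{-2} ⊆ C^{2,α}_{-1}` on `{R₁ < ‖x‖}`, `R₁ ≥ e.R > 0`), so only the expansions are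
  recorded. Def. 4 is stated for data that are asymptotically flat of type `(p, q, q₀, α)`; the
  expansions imply the Sobolev decay `(g - δ, π) ∈ W^{2,p}_{-q} × W^{1,p}_{-1-q}` for all
  `p > 3`, `q ∈ (1/2, 1)` (from the weighted sup bounds alone) and `(μ, J) ∈ C^{0,α}_{-n-q₀}`:
  with `q₀ = 1` when Def. 2 is read literally throughout (Eichmair 2013, p. 3: "for an initial
  data set that has harmonic asymptotics of type `(ℓ, α)` we have that
  `(μ, J) = O^{ℓ-2,α}(|x|^{-n-1})`"; `μ`, `J` are second-order expressions in `u`, `Y` with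
  `Δ(a|x|^{2-n}) = 0`), and with `q₀ = 1 - α > 0` when Def. 3 is read with the standard class
  (the literal `C^{k,α}_{-q}` lies in the standard `C^{k,α}_{-q+α}` on `{R₁ < ‖x‖}`, by the same
  splitting), i.e. type `(p, q, q₀, α)` in either reading, so no separate decay clause is needed
  to make `HasHarmonicAsymptotics` imply the hypotheses of EHLS, Thm. 1.
* *The density theorem as a hypothesis: `AFEnd.HasHarmonicApproximation` and `hd`.* The
  per-`ε` conclusion of Thm. 18 that the reduction consumes is the predicate
  `e.HasHarmonicApproximation D ε`: new data `D'` on the same `X` read in the same chart `e`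
  ("on `M`", "all in the same chart") with: a Levi-Civita connection and completeness (Thm. 18
  produces an *initial data set*, Def. 3, which is complete; for `ḡ = u⁴ δ` near infinity on a
  one-ended `M` this is also immediate), the strict dominant energy condition, harmonic
  asymptotics for some `α ∈ (0, 1)` (in the original chart, with the expansions of Def. 4:
  Prop. 24, reached in §6.3 through the cut-off `ξ_l`, which makes the sources decay like
  `|x|^{-n-q₀-1}`), and ADM energy–momentum `(Ē, P̄)` (limits that exist, §2) with `|E - Ē| < ε`,
  `|Pᵢ - P̄ᵢ| < ε`. The `W^{2,p}_{-q} × W^{1,p}_{-1-q}`-closeness of `(ḡ, π̄)` to `(g, π)` is not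
  recorded (dropping conclusions keeps the predicate a consequence of the printed theorem). The
  hypothesis `hd` of `positive_mass_theorem_spacetime_of_density` is the density theorem in this
  vocabulary: like the facts of `MassInequalities.lean` it quantifies over the data manifold
  `X : Type` and the standing Levi-Civita instance; its hypotheses are exactly those of
  `positive_mass_theorem_spacetime` (which imply those of Thm. 18 for `n = 3` and every `p > 3`,
  `q ∈ (1/2, 1)`, `α ∈ (0, 1)`: module docstring of `MassInequalities.lean`, *Decay classes*;
  `AFEnd` is a pure chart structure and `IsSoleEnd` supplies the compact `K` of Def. 3), and its
  conclusion is `e.HasHarmonicApproximation D ε` for every `ε > 0`. *Regularity:* Thm. 18 as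
  printed yields `(ḡ, π̄)` of the regularity of Def. 3 (`C^{2,α}_{loc} × C^{1,α}_{loc}`); `D'` is
  an `InitialDataSet` of this tree (smooth, as `D` is) by the Remark following Thm. 18: *"If we
  assume appropriate higher regularity for `(M, g, π)`, then `(M, ḡ, π̄)` will have the same
  regularity. This follows from applying Schauder estimates throughout the proof."* The flux
  normalisations agree (`2(n-1)ω_{n-1} = 16π`, `(n-1)ω_{n-1} = 8π` for `n = 3`), and the sign
  convention for `k` is immaterial (`|J|`, `|P - P̄|`). So `hd` is Thm. 18 for `n = 3` with
  strengthened hypotheses and weakened conclusions — implied by the printed theorem with its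
  Remark (the audit of this review, agreeing with the fact's original review) — and the
  reduction applies verbatim once Thm. 18 is available in any form implying `hd`.

## References

* M. Eichmair, L.-H. Huang, D. A. Lee, R. Schoen, *The spacetime positive mass theorem in
  dimensions less than eight*, J. Eur. Math. Soc. 18 (2016) 83–121 (arXiv:1110.2087): §2
  Defs. 1–4 (p. 5 of the arXiv version), §3 first paragraph (p. 8), §6 Thm. 18, the Remark
  following it (higher regularity is preserved, by Schauder estimates) and Prop. 19 (p. 20).
* M. Eichmair, *The Jang equation reduction of the spacetime positive energy theorem in
  dimensions less than eight*, Comm. Math. Phys. 319 (2013) 575–593 (arXiv:1206.2553), p. 3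
  (harmonic asymptotics of type `(ℓ, α)`; Thm. 2 = the density theorem).
* R. Bartnik, *The mass of an asymptotically flat manifold*, Comm. Pure Appl. Math. 39 (1986)
  661–693, (1.3) (weighted Hölder norms).
* J. Corvino, R. Schoen, *On the asymptotics for the vacuum Einstein constraint equations*,
  J. Differential Geom. 73 (2006) 185–217 (harmonic asymptotics in the vacuum case).
-/

noncomputable section

open Bundle Set Manifold TopologicalSpace Filter Asymptotics
open scoped ContDiff Topology Manifold Real

namespace Literature.Geometry.Lorentzian

/-! ### Weighted Hölder classes on an exterior region -/

section WeightedHolder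

variable {G F : Type*} [NormedAddCommGroup G] [NormedSpace ℝ G] [NormedAddCommGroup F]
  [NormedSpace ℝ F]

/-- **Weighted Hölder class `C^{k,α}_{-q}` on the exterior region `{R₁ < ‖x‖}`**
(Eichmair–Huang–Lee–Schoen, J. Eur. Math. Soc. 18 (2016), §2, Def. 2, transcribed literally:
`‖f‖ = ∑_{|I| ≤ k} sup_x ||x|^{|I|+q} ∂^I f(x)| + ∑_{|I| = k} [|x|^{|I|+q} ∂^I f]_α < ∞`): `f` is
`C^k` on the open exterior region, `‖x‖^{m+q} ‖D^m f(x)‖` is bounded there for every `m ≤ k`,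
and the weighted top derivative `x ↦ ‖x‖^{k+q} D^k f(x)` has finite `α`-Hölder seminorm on the
region: `‖‖x‖^{k+q} D^k f(x) - ‖y‖^{k+q} D^k f(y)‖ ≤ C ‖x - y‖^α` for all `x, y` there. Informally
`f = O^{k,α}(|x|^{-q})`: each derivative gains one power of decay. `D^m f = iteratedFDeriv ℝ m f`
(honest on the open region where `f` is `C^k`). The standard scale-invariant class (Bartnik
1986, (1.3)) is contained in this one on `{R₁ < ‖x‖}`, `R₁ > 0` (module docstring).
[cite: EichmairHuangLeeSchoen2016, §2 Def. 2] -/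
def MemWeightedHolder (R₁ : ℝ) (k : ℕ) (α q : ℝ) (f : G → F) : Prop :=
  ContDiffOn ℝ k f {x : G | R₁ < ‖x‖} ∧
  (∀ m : ℕ, m ≤ k → ∃ C : ℝ, ∀ x : G, R₁ < ‖x‖ →
      ‖x‖ ^ ((m : ℝ) + q) * ‖iteratedFDeriv ℝ m f x‖ ≤ C) ∧
  ∃ C : ℝ, ∀ x y : G, R₁ < ‖x‖ → R₁ < ‖y‖ →
      ‖‖x‖ ^ ((k : ℝ) + q) • iteratedFDeriv ℝ k f x -
          ‖y‖ ^ ((k : ℝ) + q) • iteratedFDeriv ℝ k f y‖ ≤ C * ‖x - y‖ ^ α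

/-- A function of class `C^{k,α}_{-q}` on `{R₁ < ‖x‖}` is `C^k` there (first clause).
EHLS 2016, Def. 2. [cite: EichmairHuangLeeSchoen2016, §2 Def. 2] -/
theorem MemWeightedHolder.contDiffOn {R₁ : ℝ} {k : ℕ} {α q : ℝ} {f : G → F}
    (h : MemWeightedHolder R₁ k α q f) : ContDiffOn ℝ k f {x : G | R₁ < ‖x‖} :=
  h.1

/-- The weighted sup bound of a function of class `C^{k,α}_{-q}`: for `m ≤ k`,
`‖x‖^{m+q} ‖D^m f(x)‖ ≤ C` on `{R₁ < ‖x‖}`. EHLS 2016, Def. 2.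
[cite: EichmairHuangLeeSchoen2016, §2 Def. 2] -/
theorem MemWeightedHolder.bound {R₁ : ℝ} {k : ℕ} {α q : ℝ} {f : G → F}
    (h : MemWeightedHolder R₁ k α q f) {m : ℕ} (hm : m ≤ k) :
    ∃ C : ℝ, ∀ x : G, R₁ < ‖x‖ → ‖x‖ ^ ((m : ℝ) + q) * ‖iteratedFDeriv ℝ m f x‖ ≤ C :=
  h.2.1 m hm

/-- The Hölder bound of the weighted top derivative `x ↦ ‖x‖^{k+q} D^k f(x)` of a function of
class `C^{k,α}_{-q}` (the seminorm `[|x|^{k+q} ∂^k f]_α` of EHLS 2016, Def. 2 is finite).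
[cite: EichmairHuangLeeSchoen2016, §2 Def. 2] -/
theorem MemWeightedHolder.holder {R₁ : ℝ} {k : ℕ} {α q : ℝ} {f : G → F}
    (h : MemWeightedHolder R₁ k α q f) :
    ∃ C : ℝ, ∀ x y : G, R₁ < ‖x‖ → R₁ < ‖y‖ →
      ‖‖x‖ ^ ((k : ℝ) + q) • iteratedFDeriv ℝ k f x -
          ‖y‖ ^ ((k : ℝ) + q) • iteratedFDeriv ℝ k f y‖ ≤ C * ‖x - y‖ ^ α :=
  h.2.2

/-- Shrinking the exterior region (enlarging the inner radius) preserves membership in the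
weighted Hölder class. EHLS 2016, Def. 2 (the ball `B` may be enlarged).
[cite: EichmairHuangLeeSchoen2016, §2 Def. 2] -/
theorem MemWeightedHolder.of_radius_le {R₁ R₂ : ℝ} {k : ℕ} {α q : ℝ} {f : G → F}
    (h : MemWeightedHolder R₁ k α q f) (hR : R₁ ≤ R₂) : MemWeightedHolder R₂ k α q f := by
  refine ⟨h.1.mono fun x hx ↦ lt_of_le_of_lt hR hx, fun m hm ↦ ?_, ?_⟩
  · obtain ⟨C, hC⟩ := h.2.1 m hm
    exact ⟨C, fun x hx ↦ hC x (lt_of_le_of_lt hR hx)⟩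
  · obtain ⟨C, hC⟩ := h.2.2
    exact ⟨C, fun x y hx hy ↦ hC x y (lt_of_le_of_lt hR hx) (lt_of_le_of_lt hR hy)⟩

/-- The weighted sup bound in `IsBigO` form: for `f` of class `C^{k,α}_{-q}` and `m ≤ k`,
`‖D^m f(x)‖ = O(‖x‖^{-(m+q)})` as `‖x‖ → ∞` (along `Bornology.cobounded`, the form used by
`AFEnd.IsAsymptoticallyFlat`). EHLS 2016, Def. 2. [cite: EichmairHuangLeeSchoen2016, §2 Def. 2] -/
theorem MemWeightedHolder.isBigO_iteratedFDeriv {R₁ : ℝ} {k : ℕ} {α q : ℝ} {f : G → F}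
    (h : MemWeightedHolder R₁ k α q f) {m : ℕ} (hm : m ≤ k) :
    (fun x ↦ ‖iteratedFDeriv ℝ m f x‖) =O[Bornology.cobounded G]
      fun x ↦ ‖x‖ ^ (-((m : ℝ) + q)) := by
  obtain ⟨C, hC⟩ := h.bound hm
  refine IsBigO.of_bound C ?_
  have h1 : ∀ᶠ x in Bornology.cobounded G, max R₁ 1 < ‖x‖ := by
    have := (Metric.hasBasis_cobounded_compl_closedBall (0 : G)).eventually_iff.2
      ⟨max R₁ 1, trivial, fun x hx ↦ (by simpa [Metric.mem_closedBall, dist_zero_right] using hx :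
        max R₁ 1 < ‖x‖)⟩
    exact this
  filter_upwards [h1] with x hx
  have hxR : R₁ < ‖x‖ := lt_of_le_of_lt (le_max_left _ _) hx
  have hx0 : 0 < ‖x‖ := lt_of_le_of_lt (le_trans zero_le_one (le_max_right _ _)) hx
  have hpow : 0 < ‖x‖ ^ ((m : ℝ) + q) := Real.rpow_pos_of_pos hx0 _
  rw [Real.norm_of_nonneg (norm_nonneg _), Real.norm_of_nonneg (Real.rpow_nonneg hx0.le _),
    Real.rpow_neg hx0.le, ← div_eq_mul_inv, le_div_iff₀ hpow, mul_comm]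
  exact hC x hxR

end WeightedHolder

/-! ### The strict dominant energy condition -/

namespace InitialDataSet

variable {E : Type*} [NormedAddCommGroup E] [NormedSpace ℝ E] {H : Type*} [TopologicalSpace H]
  {I : ModelWithCorners ℝ E H} {X : Type*} [TopologicalSpace X] [ChartedSpace H X]
  [IsManifold I ∞ X] [FiniteDimensional ℝ E]

/-- The data satisfy the **strict dominant energy condition** `|J|_h < μ` at every point
(`|J|²_h = h^{ij} J_i J_j`, `PseudoRiemannianMetric.innerDual`; compare
`SatisfiesDominantEnergyCondition`, the non-strict `|J|_h ≤ μ`). Eichmair–Huang–Lee–Schoen,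
J. Eur. Math. Soc. 18 (2016), §3 (first paragraph) and Thm. 18 ("the strict dominant energy
condition `μ̄ > |J̄|_ḡ`"). Our `μ`, `J` are those of EHLS, Def. 3 divided by `8π`, which does
not affect the condition. [cite: EichmairHuangLeeSchoen2016, §3 and Thm. 18] -/
def SatisfiesStrictDominantEnergyCondition (D : InitialDataSet I X) [D.metric.HasLeviCivita] :
    Prop :=
  ∀ x, Real.sqrt (D.metric.innerDual x (D.momentumDensity x) (D.momentumDensity x))
    < D.energyDensity x

/-- The strict dominant energy condition implies the dominant energy condition.
EHLS 2016, §3. [cite: EichmairHuangLeeSchoen2016, §3] -/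
theorem SatisfiesStrictDominantEnergyCondition.satisfiesDominantEnergyCondition
    {D : InitialDataSet I X} [D.metric.HasLeviCivita]
    (h : D.SatisfiesStrictDominantEnergyCondition) : D.SatisfiesDominantEnergyCondition :=
  fun x ↦ (h x).le

/-- Under the strict dominant energy condition the energy density is positive everywhere
(`0 ≤ |J|_h < μ`). EHLS 2016, §3. [cite: EichmairHuangLeeSchoen2016, §3] -/
theorem SatisfiesStrictDominantEnergyCondition.energyDensity_pos
    {D : InitialDataSet I X} [D.metric.HasLeviCivita]
    (h : D.SatisfiesStrictDominantEnergyCondition) (x : X) : 0 < D.energyDensity x :=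
  lt_of_le_of_lt (Real.sqrt_nonneg _) (h x)

end InitialDataSet

/-! ### Harmonic asymptotics in the chart of an end (`n = 3`) -/

/-- The chart components `(L_Y δ)_ij - (div_δ Y) δ_ij = ∂ᵢ Yⱼ + ∂ⱼ Yᵢ - (∑ₗ ∂ₗ Yₗ) δᵢⱼ` of the
**modified Lie derivative** of the flat metric along a vector field `Y : E3 → E3`
(`∂ᵢ Yⱼ (x) = fderiv ℝ Y x eᵢ` read in component `j`, `eᵢ = EuclideanSpace.single i 1`; junk `0`
where `Y` is not differentiable). Eichmair–Huang–Lee–Schoen, J. Eur. Math. Soc. 18 (2016), §2,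
Def. 4 (`π_ij = u^{2/(n-2)} [(L_Y δ)_ij - (div_δ Y) δ_ij]`) and §6.1
(`𝓛_g Y = L_Y g - (div_g Y) g`). [cite: EichmairHuangLeeSchoen2016, §2 Def. 4] -/
def modifiedLieDerivCoeff (Y : E3 → E3) (i j : Fin 3) (x : E3) : ℝ :=
  fderiv ℝ Y x (EuclideanSpace.single i (1 : ℝ)) j +
    fderiv ℝ Y x (EuclideanSpace.single j (1 : ℝ)) i -
    if i = j then ∑ l : Fin 3, fderiv ℝ Y x (EuclideanSpace.single l (1 : ℝ)) l else 0

/-- The modified Lie derivative coefficients are symmetric in `i`, `j`. EHLS 2016, Def. 4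
(`π` is symmetric). [cite: EichmairHuangLeeSchoen2016, §2 Def. 4] -/
theorem modifiedLieDerivCoeff_symm (Y : E3 → E3) (i j : Fin 3) (x : E3) :
    modifiedLieDerivCoeff Y i j x = modifiedLieDerivCoeff Y j i x := by
  unfold modifiedLieDerivCoeff
  by_cases hij : i = j
  · subst hij
    rfl
  · rw [if_neg hij, if_neg (Ne.symm hij)]
    ring

namespace AFEnd

variable {X : Type*} [TopologicalSpace X] [ChartedSpace E3 X] [IsManifold (𝓡 3) ∞ X]

/-- The **chart components of the momentum tensor** `π = k - (tr_h k) h` of the data on the end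
`e`: `π_ij (x) = k_ij (x) - (tr_h k)(x) h_ij (x)` with `k_ij`, `tr_h k`, `h_ij` the chart
functions `kCoeff`, `trKCoeff`, `hCoeff` (junk values inside the ball `‖x‖ ≤ e.R`:
`π_ij = 0 - 0 · δ_ij = 0`). This is the integrand of `AFEnd.admMomentumFlux`.
Eichmair–Huang–Lee–Schoen, J. Eur. Math. Soc. 18 (2016), §2, Def. 3 (`π = k - (tr_g k) g`).
[cite: EichmairHuangLeeSchoen2016, §2 Def. 3] -/
def momentumTensorCoeff (e : AFEnd X) (D : InitialDataSet (𝓡 3) X) (i j : Fin 3) (x : E3) : ℝ :=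
  kCoeff e D x (EuclideanSpace.single i (1 : ℝ)) (EuclideanSpace.single j (1 : ℝ)) -
    trKCoeff e D x *
      hCoeff e D x (EuclideanSpace.single i (1 : ℝ)) (EuclideanSpace.single j (1 : ℝ))

/-- The momentum tensor components are symmetric (`k` and `h` are). EHLS 2016, Def. 3.
[cite: EichmairHuangLeeSchoen2016, §2 Def. 3] -/
theorem momentumTensorCoeff_symm (e : AFEnd X) (D : InitialDataSet (𝓡 3) X) (i j : Fin 3)
    (x : E3) : momentumTensorCoeff e D i j x = momentumTensorCoeff e D j i x := by
  unfold momentumTensorCoeff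
  rw [kCoeff_symm, hCoeff_symm]

/-- The ADM momentum flux is the flux of the momentum tensor:
`Pᵢ(r) = (8π)⁻¹ ∫_{‖x‖ = r} ∑ⱼ π_ij (x) xʲ/r dσ` (definitional unfolding of
`AFEnd.admMomentumFlux`). EHLS 2016, §2 (definition of `P`).
[cite: EichmairHuangLeeSchoen2016, §2 Def. 3] -/
theorem admMomentumFlux_eq_integral_momentumTensorCoeff (e : AFEnd X)
    (D : InitialDataSet (𝓡 3) X) (i : Fin 3) (r : ℝ) :
    admMomentumFlux e D i r =
      (8 * Real.pi)⁻¹ *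
        ∫ x in Metric.sphere (0 : E3) r, ∑ j : Fin 3, momentumTensorCoeff e D i j x * x j / r
          ∂(MeasureTheory.Measure.euclideanHausdorffMeasure 2 : MeasureTheory.Measure E3) :=
  rfl

/-- **Harmonic asymptotics** of the data `D` on the end `e`, with Hölder exponent `α`
(Eichmair–Huang–Lee–Schoen, J. Eur. Math. Soc. 18 (2016), §2, Def. 4, for `n = 3`): there are a
radius `R₁ ≥ e.R`, functions `u : E3 → ℝ`, `Y : E3 → E3` and constants `a ∈ ℝ`, `b ∈ ℝ³` such
that on `{R₁ < ‖x‖}`, in the chart of the end,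
`h_ij = u⁴ δ_ij` and `π_ij = u² [(L_Y δ)_ij - (div_δ Y) δ_ij]`, where
`u(x) = 1 + a |x|⁻¹ + O^{2,α}(|x|⁻²)` and `Yᵢ(x) = bᵢ |x|⁻¹ + O^{2,α}(|x|⁻²)`, the remainders lying
in the weighted Hölder class `C^{2,α}_{-2}` (`MemWeightedHolder R₁ 2 α 2`). (In the source:
`g_ij = u^{4/(n-2)} δ_ij`, `π_ij = u^{2/(n-2)}[(L_Y δ)_ij - (div_δ Y) δ_ij]`,
`u = 1 + a|x|^{2-n} + O^{2,α}(|x|^{1-n})`, `Yᵢ = bᵢ|x|^{2-n} + O^{2,α}(|x|^{1-n})`,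
`u, Y ∈ C^{2,α}_{2-n}`; the last membership follows from the expansions, see the module
docstring.) Then
`a = E/2` and `bᵢ = -2Pᵢ` (EHLS, proof of Lemma 5). [cite: EichmairHuangLeeSchoen2016, §2 Def. 4] -/
def HasHarmonicAsymptotics (e : AFEnd X) (D : InitialDataSet (𝓡 3) X) (α : ℝ) : Prop :=
  ∃ (R₁ : ℝ) (u : E3 → ℝ) (Y : E3 → E3) (a : ℝ) (b : E3), e.R ≤ R₁ ∧
    MemWeightedHolder R₁ 2 α 2 (fun x ↦ u x - 1 - a * ‖x‖⁻¹) ∧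
    MemWeightedHolder R₁ 2 α 2 (fun x ↦ Y x - ‖x‖⁻¹ • b) ∧
    (∀ x : E3, R₁ < ‖x‖ → hCoeff e D x = (u x) ^ 4 • (innerSL ℝ (E := E3) : E3 →L[ℝ] E3 →L[ℝ] ℝ)) ∧
    (∀ x : E3, R₁ < ‖x‖ → ∀ i j : Fin 3,
      momentumTensorCoeff e D i j x = (u x) ^ 2 * modifiedLieDerivCoeff Y i j x)

/-- Harmonic asymptotics give the conformally flat form of the metric in the chart:
`h_ij (x) = u(x)⁴ δ_ij` beyond some radius `R₁ ≥ e.R`. EHLS 2016, Def. 4.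
[cite: EichmairHuangLeeSchoen2016, §2 Def. 4] -/
theorem HasHarmonicAsymptotics.exists_hCoeff_eq {e : AFEnd X} {D : InitialDataSet (𝓡 3) X}
    {α : ℝ} (h : HasHarmonicAsymptotics e D α) :
    ∃ (R₁ : ℝ) (u : E3 → ℝ), e.R ≤ R₁ ∧ ∀ x : E3, R₁ < ‖x‖ →
      hCoeff e D x = (u x) ^ 4 • (innerSL ℝ (E := E3) : E3 →L[ℝ] E3 →L[ℝ] ℝ) := by
  obtain ⟨R₁, u, -, -, -, hR, -, -, hh, -⟩ := h
  exact ⟨R₁, u, hR, hh⟩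

end AFEnd

end Literature.Geometry.Lorentzian

namespace Literature.Geometry.Lorentzian


/-! ### Harmonic approximants: the conclusion of the density theorem (EHLS, Thm. 18), `n = 3` -/

namespace AFEnd

variable {X : Type*} [TopologicalSpace X] [ChartedSpace E3 X] [IsManifold (𝓡 3) ∞ X]

/-- **Harmonic approximants within `ε`** — the conclusion of the density theorem
(Eichmair–Huang–Lee–Schoen, J. Eur. Math. Soc. 18 (2016), §6, Thm. 18, for `n = 3`) as a
*predicate* on the data; the theorem itself is the hypothesis `hd` of
`positive_mass_theorem_spacetime_of_density` and not a named fact (module docstring). *Thm. 18: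
let `(M, g, π)` be an asymptotically flat initial data set of type `(p, q, q₀, α)` satisfying the
dominant energy condition `μ ≥ |J|_g`. For every `ε > 0` there exists asymptotically flat initial
data `(ḡ, π̄)` on `M` of the same type and with harmonic asymptotics (all in the same chart) such
that `‖g - ḡ‖_{W^{2,p}_{-q}} < ε`, `‖π - π̄‖_{W^{1,p}_{-1-q}} < ε`, the strict dominant energy
condition `μ̄ > |J̄|_ḡ` holds, and `|E - Ē| < ε`, `|P - P̄| < ε`.* `e.HasHarmonicApproximation D ε`
records, for the data `D` and the end `e`: there are data `D'` on the same `X`, with a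
Levi-Civita connection and complete (an initial data set in the sense of Def. 3), satisfying the
strict dominant energy condition (`SatisfiesStrictDominantEnergyCondition`), with harmonic
asymptotics on the same end `e` for some `α ∈ (0, 1)` (`AFEnd.HasHarmonicAsymptotics`, Def. 4 for
`n = 3`), whose ADM energy and momentum limits `Ē = m'`, `P̄ᵢ = p'ᵢ` exist with `|E - m'| < ε`
and `|Pᵢ - p'ᵢ| < ε` for each `i` (`E = e.admEnergy D`, `Pᵢ = e.admMomentum D i`; componentwise,
implied by `|P - P̄| < ε`). The Sobolev closeness of `(ḡ, π̄)` to `(g, π)` is not recorded;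
*regularity:* Thm. 18 as printed yields `(ḡ, π̄)` of the regularity of Def. 3
(`C^{2,α}_{loc} × C^{1,α}_{loc}`), and `D'` is an `InitialDataSet` of this tree (smooth, as `D` is)
by the Remark following Thm. 18: *"If we assume appropriate higher regularity for `(M, g, π)`,
then `(M, ḡ, π̄)` will have the same regularity. This follows from applying Schauder estimates
throughout the proof."* For the data of `positive_mass_theorem_spacetime` and every `ε > 0` this
is what Thm. 18 provides (module docstring, *Design choices*).
[cite: EichmairHuangLeeSchoen2016, Thm. 18 (§6) and the Remark following it, with §2 Defs. 2–4] -/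
def HasHarmonicApproximation (e : AFEnd X) (D : InitialDataSet (𝓡 3) X) (ε : ℝ) : Prop :=
  ∃ (D' : InitialDataSet (𝓡 3) X) (_ : D'.metric.HasLeviCivita),
    D'.IsComplete ∧ D'.SatisfiesStrictDominantEnergyCondition ∧
    (∃ α : ℝ, 0 < α ∧ α < 1 ∧ e.HasHarmonicAsymptotics D' α) ∧
    (∃ m' : ℝ, e.HasADMEnergy D' m' ∧ |e.admEnergy D - m'| < ε) ∧
    (∀ i : Fin 3, ∃ p' : ℝ, e.HasADMMomentum D' i p' ∧ |e.admMomentum D i - p'| < ε)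

/-- A harmonic approximant within `ε` forces `ε > 0` (`0 ≤ |E - m'| < ε`); Thm. 18 is stated for
`ε > 0`. EHLS 2016, Thm. 18. [cite: EichmairHuangLeeSchoen2016, Thm. 18 (§6)] -/
theorem HasHarmonicApproximation.pos {e : AFEnd X} {D : InitialDataSet (𝓡 3) X} {ε : ℝ}
    (h : e.HasHarmonicApproximation D ε) : 0 < ε := by
  obtain ⟨-, -, -, -, -, ⟨m', -, hE⟩, -⟩ := h
  exact lt_of_le_of_lt (abs_nonneg _) hE

/-- Harmonic approximants within `ε` are harmonic approximants within every `ε' ≥ ε` (the same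
data `D'`). EHLS 2016, Thm. 18. [cite: EichmairHuangLeeSchoen2016, Thm. 18 (§6)] -/
theorem HasHarmonicApproximation.mono {e : AFEnd X} {D : InitialDataSet (𝓡 3) X} {ε ε' : ℝ}
    (h : e.HasHarmonicApproximation D ε) (hε : ε ≤ ε') : e.HasHarmonicApproximation D ε' := by
  obtain ⟨D', hLC, hc, hs, hh, ⟨m', hm', hE⟩, hP⟩ := h
  exact ⟨D', hLC, hc, hs, hh, ⟨m', hm', lt_of_lt_of_le hE hε⟩,
    fun i ↦ (hP i).imp fun p' hp' ↦ ⟨hp'.1, lt_of_lt_of_le hp'.2 hε⟩⟩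

/-- **The trivial case of the density theorem** (non-vacuity of the predicate): complete data
that already satisfy the strict dominant energy condition and have harmonic asymptotics, with
existing ADM energy and momentum limits, are their own harmonic approximant within every `ε > 0`
(`D' = D`, `|E - E| = |Pᵢ - Pᵢ| = 0 < ε`, by `HasADMEnergy.admEnergy_eq`,
`HasADMMomentum.admMomentum_eq`). EHLS 2016, Thm. 18 (for such data there is nothing to prove).
[cite: EichmairHuangLeeSchoen2016, Thm. 18 (§6)] -/
theorem hasHarmonicApproximation_self (e : AFEnd X) (D : InitialDataSet (𝓡 3) X)
    [D.metric.HasLeviCivita] (hc : D.IsComplete) (hs : D.SatisfiesStrictDominantEnergyCondition)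
    (hh : ∃ α : ℝ, 0 < α ∧ α < 1 ∧ e.HasHarmonicAsymptotics D α)
    (hE : ∃ m, e.HasADMEnergy D m) (hP : ∀ i, ∃ p, e.HasADMMomentum D i p) {ε : ℝ} (hε : 0 < ε) :
    e.HasHarmonicApproximation D ε := by
  obtain ⟨m, hm⟩ := hE
  choose p hp using hP
  refine ⟨D, ‹_›, hc, hs, hh, ⟨m, hm, ?_⟩, fun i ↦ ⟨p i, hp i, ?_⟩⟩
  · rw [hm.admEnergy_eq, sub_self, abs_zero]; exact hε
  · rw [(hp i).admMomentum_eq, sub_self, abs_zero]; exact hε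

end AFEnd

/-! ### The reduction: density theorem + Thm. 1 on harmonic data ⟹ `positive_mass_theorem_spacetime` -/

/-- `√(∑ᵢ vᵢ²)` is the Euclidean length of the vector `(v₁, v₂, v₃) ∈ ℝ³`
(`EuclideanSpace.norm_eq`). [folklore] -/
theorem sqrt_sum_sq_eq_norm (v : Fin 3 → ℝ) :
    Real.sqrt (∑ i, v i ^ 2) = ‖(WithLp.toLp 2 v : E3)‖ := by
  rw [EuclideanSpace.norm_eq]
  simp [Real.norm_eq_abs, sq_abs]

/-- Triangle inequality for Euclidean lengths: `|v| ≤ |w| + |v - w|`. [folklore] -/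
theorem sqrt_sum_sq_le_add (v w : Fin 3 → ℝ) :
    Real.sqrt (∑ i, v i ^ 2) ≤ Real.sqrt (∑ i, w i ^ 2) + Real.sqrt (∑ i, (v i - w i) ^ 2) := by
  have h : Real.sqrt (∑ i, (v i - w i) ^ 2) = ‖(WithLp.toLp 2 v : E3) - WithLp.toLp 2 w‖ := by
    rw [← WithLp.toLp_sub, ← sqrt_sum_sq_eq_norm]
    rfl
  rw [sqrt_sum_sq_eq_norm, sqrt_sum_sq_eq_norm, h]
  exact norm_le_insert' _ _

/-- Componentwise closeness controls the Euclidean length of the difference: if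
`|vᵢ - wᵢ| < ε` for `i = 1, 2, 3` then `|v - w| < 2ε` (indeed `≤ √3 ε`). [folklore] -/
theorem sqrt_sum_sq_sub_lt_of_abs_lt {v w : Fin 3 → ℝ} {ε : ℝ} (h : ∀ i, |v i - w i| < ε) :
    Real.sqrt (∑ i, (v i - w i) ^ 2) < 2 * ε := by
  have hε : 0 < ε := lt_of_le_of_lt (abs_nonneg _) (h 0)
  have hsq : ∀ i, (v i - w i) ^ 2 < ε ^ 2 := fun i ↦ by
    have := h i
    rw [abs_lt] at this
    nlinarith [this.1, this.2]
  rw [Real.sqrt_lt' (by positivity), Fin.sum_univ_three]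
  nlinarith [hsq 0, hsq 1, hsq 2]

/-- **The spacetime positive mass theorem follows from the density theorem and its
harmonic-asymptotics case** — the top layer of the proof of Eichmair–Huang–Lee–Schoen,
J. Eur. Math. Soc. 18 (2016), Thm. 1 (§3, first paragraph: *"By the density theorem (Theorem 18),
we can assume without loss of generality, that `(g, k)` has harmonic asymptotics and satisfies
the strict dominant energy condition `μ > |J|_g`"*), proved. Hypotheses, both spelled out in
full (neither is a named fact, module docstring): `hd`, *the density theorem, Thm. 18 (§6) for
`n = 3`* — for data as in `positive_mass_theorem_spacetime` (dominant energy condition, asymptotic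
flatness of order `1` on `e` with `HasSourceDecay e D q₀`, together giving type `(p, q, q₀, α)`
for all `p > 3`, `q ∈ (1/2, 1)`, `α ∈ (0, 1)`; `e` the only end; completeness; existence of the
ADM limits of `D`, asserted in §2 and kept so that `admEnergy`, `admMomentum` are no junk values)
and every `ε > 0`, a harmonic approximant within `ε` (`AFEnd.HasHarmonicApproximation`: complete
data `D'` on the same `X` and end with the strict dominant energy condition, harmonic asymptotics
and `ε`-close ADM limits; implied by the printed Thm. 18 with its Remark, see that predicate and
the module docstring, *Design choices*) — and `hh`, *Thm. 1 for `n = 3` on the data the density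
theorem produces* — the strict
dominant energy condition `|J|_h < μ` (`SatisfiesStrictDominantEnergyCondition`), harmonic
asymptotics on the end `e` for some `α ∈ (0, 1)` (`AFEnd.HasHarmonicAsymptotics`, Def. 4 for
`n = 3`), `e` the only end, completeness, existence of the ADM energy and momentum limits
(asserted in §2; kept so that `admEnergy`, `admMomentum` are no junk values) `⟹ |P| ≤ E`. This
is the case §3 (Lemma 5: the planes `x³ = ±Λ` are barriers for MOTS when `E < |P|`; Lemma 6:
stable MOTS `Σ_{ρ,h}` in the cylinder `C_{ρ,Λ}` with boundary `Γ_{ρ,h}`; Lemmas 7–8: a complete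
properly embedded limit MOTS `Σ_∞`, asymptotic to a plane; Lemma 10: its stability inequality)
and §4 (`n = 3`: logarithmic cut-off, `∫ Q ≥ 0`, strict dominant energy condition `⟹ ∫ K > 0`,
contradicting Gauss–Bonnet on `Σ'_∞ ∩ C_r`) prove; it is Thm. 1 itself on a dense subclass of
its data and, like `hd`, deliberately *not* a named fact (module docstring): whoever
discharges `positive_mass_theorem_spacetime` along this route supplies both. *`hh` is not stronger
than
Thm. 1:* its data are asymptotically flat initial data sets of type `(p, q, q₀, α)` in the sense
of Def. 3 for every `p > 3`, `q ∈ (1/2, 1)` — the chart is `e` restricted to `{R₂ < ‖x‖}`,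
`R₂ ≥ R₁`, whose complement is compact (`IsSoleEnd` and compactness of the closed annulus
image); `g - δ = (u⁴ - 1) δ ∈ C²_{-1}` and `π ∈ C¹_{-2}` from the weighted sup bounds of Def. 4,
whence the Sobolev decay `(g - δ, k) ∈ W^{2,p}_{-q} × W^{1,p}_{-1-q}`; and
`(μ, J) ∈ C^{0,α}_{-3-q₀}` with `q₀ = 1` when Def. 2 is read literally as in `MemWeightedHolder`
(the leading terms drop out because `Δ_δ |x|⁻¹ = 0` and
`div_δ (L_{b/|x|} δ - (div_δ (b/|x|)) δ) = Δ_δ (b/|x|) = 0` away from the origin, so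
`R_g = -8 u⁻⁵ Δ_δ u` and `J = div_g π` are, up to products of decaying factors, second
derivatives of the remainders `O^{2,α}(|x|⁻²)`, i.e. `O^{0,α}(|x|⁻⁴)`, while
`|k|²_g, (tr_g k)² = O¹(|x|⁻⁴)`; Eichmair, Comm. Math. Phys. 319 (2013), p. 3:
`(μ, J) = O^{ℓ-2,α}(|x|^{-n-1})` under harmonic asymptotics of type `(ℓ, α)`), and with
`q₀ = 1 - α > 0` in the standard scale-invariant reading of Def. 2 (the literal class
`C^{0,α}_{-4}` lies in the standard `C^{0,α}_{-4+α}` on `{R₁ < ‖x‖}`, module docstring); the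
strict dominant energy condition implies the dominant energy condition. Proof (the printed
`ε`-argument): given data `D` as in `positive_mass_theorem_spacetime` and `ε > 0`, `hd` provides
complete data `D'` on the same manifold and end with the strict dominant energy
condition, harmonic asymptotics and ADM energy–momentum `(Ē, P̄)` with `|E - Ē| < ε/3`,
`|Pᵢ - P̄ᵢ| < ε/3`; `hh` gives `|P̄| ≤ Ē`; hence `|P| ≤ |P̄| + |P - P̄| < Ē + 2ε/3 < E + ε`, and
`ε > 0` was arbitrary. (The time-symmetric case `positive_mass_theorem_riemannian` then follows
by `positive_mass_theorem_riemannian_of_spacetime`, `MassInequalitiesProofs.lean`.)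
[cite: EichmairHuangLeeSchoen2016, Thm. 1 via Thm. 18 and §3 first paragraph; §3 Lemmas 5–8 and 10, §4] -/
theorem positive_mass_theorem_spacetime_of_density
    (hd : ∀ (X : Type) [TopologicalSpace X] [ChartedSpace E3 X] [IsManifold (𝓡 3) ∞ X]
      [T2Space X] [SecondCountableTopology X] [ConnectedSpace X]
      (D : InitialDataSet (𝓡 3) X) [D.metric.HasLeviCivita] (e : AFEnd X),
      D.SatisfiesDominantEnergyCondition → e.IsAsymptoticallyFlat D 1 →
      (∃ q₀, HasSourceDecay e D q₀) → e.IsSoleEnd → D.IsComplete →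
      (∃ m, e.HasADMEnergy D m) → (∀ i, ∃ p, e.HasADMMomentum D i p) →
      ∀ ε : ℝ, 0 < ε → e.HasHarmonicApproximation D ε)
    (hh : ∀ (X : Type) [TopologicalSpace X] [ChartedSpace E3 X] [IsManifold (𝓡 3) ∞ X]
      [T2Space X] [SecondCountableTopology X] [ConnectedSpace X]
      (D : InitialDataSet (𝓡 3) X) [D.metric.HasLeviCivita] (e : AFEnd X),
      D.SatisfiesStrictDominantEnergyCondition →
      (∃ α : ℝ, 0 < α ∧ α < 1 ∧ e.HasHarmonicAsymptotics D α) →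
      e.IsSoleEnd → D.IsComplete →
      (∃ m, e.HasADMEnergy D m) → (∀ i, ∃ p, e.HasADMMomentum D i p) →
      Real.sqrt (∑ i : Fin 3, e.admMomentum D i ^ 2) ≤ e.admEnergy D) :
    positive_mass_theorem_spacetime := by
  intro X _ _ _ _ _ _ D _ e hdec hAF hsrc hsole hcompl hE hP
  refine le_of_forall_pos_lt_add fun ε hε ↦ ?_
  obtain ⟨D', hLC, hcompl', hsdec', hharm', ⟨m', hm', hEm'⟩, hP'⟩ :=
    hd X D e hdec hAF hsrc hsole hcompl hE hP (ε / 3) (by positivity)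
  choose p' hp' hPp' using hP'
  -- the harmonic case applied to `D'`
  have hle : Real.sqrt (∑ i : Fin 3, e.admMomentum D' i ^ 2) ≤ e.admEnergy D' :=
    hh X D' e hsdec' hharm' hsole hcompl' ⟨m', hm'⟩ fun i ↦ ⟨p' i, hp' i⟩
  rw [hm'.admEnergy_eq] at hle
  have hPeq : ∀ i, e.admMomentum D' i = p' i := fun i ↦ (hp' i).admMomentum_eq
  simp only [hPeq] at hle
  -- `|P| ≤ |P̄| + |P - P̄|`, `|P - P̄| < 2ε/3`, `Ē < E + ε/3`
  have htri := sqrt_sum_sq_le_add (fun i ↦ e.admMomentum D i) p'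
  have hdiff : Real.sqrt (∑ i, (e.admMomentum D i - p' i) ^ 2) < 2 * (ε / 3) :=
    sqrt_sum_sq_sub_lt_of_abs_lt hPp'
  have hE' : m' < e.admEnergy D + ε / 3 := by
    have := hEm'
    rw [abs_lt] at this
    linarith [this.1, this.2]
  linarith

end Literature.Geometry.Lorentzian

end
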